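import Summits.CriticalPhenomena.PercolationContinuityZ3.Theorems.PercRayRenewalJumpLineAvoidanceDecayTwoPointPointwise
import HarnessLib

/-!
# Truncated one-arm decay forces axial decay of the connected two-point function

Route `PercRayRenewal`, item `JumpLineAvoidanceDecay` (stmt-CriticalPhenomena-4626), helper file.
For nearest-neighbour bond percolation on `ℤ³` at ANY density `p ∈ [0, 1]`: if the truncated
one-arm probability decays like a power,
`π^f_n := P_p({0 ↔ ∂Λ_n in Λ_n} ∖ {0 ↔ ∞}) ≤ C n^{-a}` (`n ≥ 1`, some `a > 0`),
then so does the connected axial two-point function: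
`τ_p(0, n e₀) - θ(p)² ≤ C' n^{-a}` (`n ≥ 1`) with the SAME exponent `a` and
`C' = 3 C 4^a + 2^a`.

Proof. The pointwise engine `real_openConn_sub_sq_le_three_mul_truncArm` (sibling file
`…TwoPointPointwise`) gives `τ_p(0, x) - θ² ≤ 3 π^f_k` for every `x ∉ Λ_{2k}`. For `n ≥ 3` take
`k = ⌊(n - 1)/2⌋ ≥ 1`: then `2k < n`, so the axis point `n e₀ ∉ Λ_{2k}`, and `4k ≥ n`, so
`k^{-a} ≤ (n/4)^{-a} = 4^a n^{-a}`; hence `τ_p(0, n e₀) - θ² ≤ 3 C k^{-a} ≤ 3 C 4^a n^{-a}`.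
For `n ∈ {1, 2}` simply `τ_p(0, n e₀) - θ² ≤ 1 ≤ 2^a n^{-a}`. (`C ≥ 0` is forced by the
hypothesis at `n = 1`.)

## References

* G. Grimmett, *Percolation*, 2nd ed., Grundlehren 321, Springer 1999, §8.5 p. 213
  (`τ_p = τ^f_p + P_p(both endpoints in infinite clusters)`) [GrimmettPercolation1999].
-/

noncomputable section

namespace Summit.CriticalPhenomena.PercolationContinuityZ3.Theorems

open MeasureTheory Literature.Probability.Percolation Literature.Probability.LatticeModels

namespace AxialTwoPoint

/-- The axis point `n e₀ = Pi.single 0 n` lies outside the box `Λ_L` as soon as `L < n`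
(its `0`-th coordinate is `n > L`). [folklore] -/
theorem single_not_mem_box {d : ℕ} (i : Fin d) {L n : ℕ} (h : L < n) :
    (Pi.single i (n : ℤ) : Site d) ∉ box d L := by
  intro hmem
  rw [mem_box] at hmem
  have h2 := (hmem i).2
  rw [Pi.single_eq_same] at h2
  omega

/-- Change of scale in a negative power: if `0 < k` and `n ≤ 4k` then
`k^{-a} ≤ 4^a n^{-a}` for `a ≥ 0`. [folklore] -/
theorem rpow_neg_le_four_rpow_mul {k n a : ℝ} (hk : 0 < k) (hn : 0 < n) (hkn : n ≤ 4 * k)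
    (ha : 0 ≤ a) : k ^ (-a) ≤ (4 : ℝ) ^ a * n ^ (-a) := by
  have h1 : ((4 : ℝ) * k) ^ (-a) ≤ n ^ (-a) :=
    Real.rpow_le_rpow_of_nonpos hn hkn (by linarith)
  rw [Real.mul_rpow (by norm_num) hk.le] at h1
  have h4 : (0 : ℝ) < (4 : ℝ) ^ a := Real.rpow_pos_of_pos (by norm_num) a
  have h4' : (4 : ℝ) ^ (-a) = ((4 : ℝ) ^ a)⁻¹ := Real.rpow_neg (by norm_num) a
  rw [h4'] at h1
  calc k ^ (-a) = (4 : ℝ) ^ a * (((4 : ℝ) ^ a)⁻¹ * k ^ (-a)) := by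
        rw [← mul_assoc, mul_inv_cancel₀ h4.ne', one_mul]
    _ ≤ (4 : ℝ) ^ a * n ^ (-a) := mul_le_mul_of_nonneg_left h1 h4.le

/-- Small scales: for `1 ≤ n ≤ 2` and `a ≥ 0`, `1 ≤ 2^a n^{-a}`. [folklore] -/
theorem one_le_two_rpow_mul {n a : ℝ} (hn1 : 0 < n) (hn2 : n ≤ 2) (ha : 0 ≤ a) :
    (1 : ℝ) ≤ (2 : ℝ) ^ a * n ^ (-a) := by
  have h1 : (2 : ℝ) ^ (-a) ≤ n ^ (-a) := Real.rpow_le_rpow_of_nonpos hn1 hn2 (by linarith)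
  have h2 : (0 : ℝ) < (2 : ℝ) ^ a := Real.rpow_pos_of_pos (by norm_num) a
  have h2' : (2 : ℝ) ^ (-a) = ((2 : ℝ) ^ a)⁻¹ := Real.rpow_neg (by norm_num) a
  rw [h2'] at h1
  calc (1 : ℝ) = (2 : ℝ) ^ a * ((2 : ℝ) ^ a)⁻¹ := (mul_inv_cancel₀ h2.ne').symm
    _ ≤ (2 : ℝ) ^ a * n ^ (-a) := mul_le_mul_of_nonneg_left h1 h2.le

end AxialTwoPoint

open AxialTwoPoint in
/-- **Truncated one-arm decay forces axial two-point decay.** For bond percolation on `ℤ³` at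
any `p ∈ [0, 1]`: if `P_p({0 ↔ ∂Λ_n in Λ_n} ∖ {0 ↔ ∞}) ≤ C n^{-a}` for all `n ≥ 1` (some
`a > 0`), then `τ_p(0, n e₀) - θ(p)² ≤ C' n^{-a}` for all `n ≥ 1`, with
`C' = 3 C 4^a + 2^a`. For `n ≥ 3` this is the pointwise engine
`real_openConn_sub_sq_le_three_mul_truncArm` at scale `k = ⌊(n-1)/2⌋` (`2k < n ≤ 4k`);
for `n ≤ 2` the left side is at most `1 ≤ 2^a n^{-a}`. [folklore] -/
theorem axialTwoPointDecay_of_truncArmDecay (p : unitInterval)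
    (hπ : ∃ a C : ℝ, 0 < a ∧ ∀ n : ℕ, 1 ≤ n →
      (bondPercolation (zdGraph 3) p).real (siteToBoundary 3 n \ percolatesAt 0) ≤
        C * (n : ℝ) ^ (-a)) :
    ∃ a C : ℝ, 0 < a ∧ ∀ n : ℕ, 1 ≤ n →
      (bondPercolation (zdGraph 3) p).real (openConn (0 : Site 3) (Pi.single 0 (n : ℤ))) -
          theta (zdGraph 3) (0 : Site 3) p ^ 2 ≤ C * (n : ℝ) ^ (-a) := by
  obtain ⟨a, C, ha, hC⟩ := hπ
  -- the constant is non-negative (instance `n = 1`)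
  have hC0 : 0 ≤ C := by
    have h := hC 1 le_rfl
    simp only [Nat.cast_one, Real.one_rpow, mul_one] at h
    exact le_trans measureReal_nonneg h
  have h4a : (0 : ℝ) ≤ (4 : ℝ) ^ a := Real.rpow_nonneg (by norm_num) a
  have h2a : (0 : ℝ) ≤ (2 : ℝ) ^ a := Real.rpow_nonneg (by norm_num) a
  refine ⟨a, 3 * C * (4 : ℝ) ^ a + (2 : ℝ) ^ a, ha, fun n hn => ?_⟩
  have hn0 : (0 : ℝ) < n := by exact_mod_cast hn
  have hna : (0 : ℝ) ≤ (n : ℝ) ^ (-a) := Real.rpow_nonneg hn0.le _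
  -- the left side is at most `1`
  have hle1 : (bondPercolation (zdGraph 3) p).real (openConn (0 : Site 3) (Pi.single 0 (n : ℤ))) -
      theta (zdGraph 3) (0 : Site 3) p ^ 2 ≤ 1 := by
    have h1 : (bondPercolation (zdGraph 3) p).real
        (openConn (0 : Site 3) (Pi.single 0 (n : ℤ))) ≤ 1 := measureReal_le_one
    nlinarith [sq_nonneg (theta (zdGraph 3) (0 : Site 3) p)]
  rcases le_or_gt n 2 with hn2 | hn3
  · -- small scales `n ∈ {1, 2}`
    have hn2' : (n : ℝ) ≤ 2 := by exact_mod_cast hn2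
    have hsmall := one_le_two_rpow_mul hn0 hn2' ha.le
    have hbig : 0 ≤ 3 * C * (4 : ℝ) ^ a * (n : ℝ) ^ (-a) := by positivity
    calc (bondPercolation (zdGraph 3) p).real (openConn (0 : Site 3) (Pi.single 0 (n : ℤ))) -
          theta (zdGraph 3) (0 : Site 3) p ^ 2 ≤ 1 := hle1
      _ ≤ (2 : ℝ) ^ a * (n : ℝ) ^ (-a) := hsmall
      _ ≤ 3 * C * (4 : ℝ) ^ a * (n : ℝ) ^ (-a) + (2 : ℝ) ^ a * (n : ℝ) ^ (-a) := by linarith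
      _ = (3 * C * (4 : ℝ) ^ a + (2 : ℝ) ^ a) * (n : ℝ) ^ (-a) := by ring
  · -- large scales `n ≥ 3`: the engine at scale `k = ⌊(n-1)/2⌋`
    set k : ℕ := (n - 1) / 2 with hk
    have hk1 : 1 ≤ k := by omega
    have h2k : 2 * k < n := by omega
    have h4k : n ≤ 4 * k := by omega
    have hk0 : (0 : ℝ) < k := by exact_mod_cast hk1
    have h4k' : (n : ℝ) ≤ 4 * k := by exact_mod_cast h4k
    have hx : (Pi.single 0 (n : ℤ) : Site 3) ∉ box 3 (2 * k) := single_not_mem_box 0 h2k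
    have heng := real_openConn_sub_sq_le_three_mul_truncArm (d := 3) p hx
    have hCk := hC k hk1
    have hscale := rpow_neg_le_four_rpow_mul hk0 hn0 h4k' ha.le
    calc (bondPercolation (zdGraph 3) p).real (openConn (0 : Site 3) (Pi.single 0 (n : ℤ))) -
          theta (zdGraph 3) (0 : Site 3) p ^ 2
        ≤ 3 * (bondPercolation (zdGraph 3) p).real (siteToBoundary 3 k \ percolatesAt 0) := heng
      _ ≤ 3 * (C * (k : ℝ) ^ (-a)) := by linarith
      _ ≤ 3 * (C * ((4 : ℝ) ^ a * (n : ℝ) ^ (-a))) := by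
          have := mul_le_mul_of_nonneg_left hscale hC0
          linarith
      _ ≤ 3 * (C * ((4 : ℝ) ^ a * (n : ℝ) ^ (-a))) + (2 : ℝ) ^ a * (n : ℝ) ^ (-a) := by
          have : 0 ≤ (2 : ℝ) ^ a * (n : ℝ) ^ (-a) := mul_nonneg h2a hna
          linarith
      _ = (3 * C * (4 : ℝ) ^ a + (2 : ℝ) ^ a) * (n : ℝ) ^ (-a) := by ring

end Summit.CriticalPhenomena.PercolationContinuityZ3.Theorems

end
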